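/-
Copyright (c) 2026 the pub-hodgecm-mathlib formalisation cell (harness21).  Prover seat hodgecm-mathlib-K2E3-p14 (g3), HCML Track B «K2-LIT» (build stream 29),
h413 = `stmt-HodgeConjecture-24833`, line `K2_E3_EllipticInputs`, unit U12 «Characters», socket #11 road (11-SC), letter (SC-an), END-GAME MAP v1 (line lead K2E3-p20 (g3),
`K2/STATUS.md` 2026-09-04T02:08:19Z ∕ deal [M2a] BY NAME 02:14:17Z): brick [M2a] «THE FRAME OF THE ONE-PLACE MODEL `U(σ_w, Φ₃)(L_w)` AT A NON-SPLIT PLACE» — FILE A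
(scalars, centre, instances, unimodularity, singular set).  2026-09-04.
-/
import Summits.HodgeConjecture.HodgeConjecture.Theorems.F0P3bLocalNonsplitCompactCenter   -- ★ `local_nonsplit_compactOpen_center_of_center_le` (compact centre of `U(H)(L⁺_v)`, `v` non-split)
import Summits.HodgeConjecture.HodgeConjecture.Theorems.F0P3cStCharTSSingularNull        -- ★ `formCongr_quasiSplitFrame_eq_diagonal` (`Φ₃ ~ diag(2,1,−2)`); brings ★ `exists_closed_null_superset_singular`, ★ `UnitaryCartanRegularAE`, ★ `qsForm`∕`Gqs`
import Summits.HodgeConjecture.HodgeConjecture.Theorems.F0P3cStCharTSModelHaarPins       -- ★ `locallyCompactSpace_unitaryGroupOfForm` (model level, any non-archimedean local field)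
import Literature.NumberTheory.Automorphic.LocalUnitaryGroupCenter                       -- ★ `exists_coe_eq_scalar_of_mem_center_unitaryGroupOfForm`, `forall_mem_center_cmLocal_eq_scalar`; brings ★ `localNonsplitEquiv`
import Literature.NumberTheory.Automorphic.LocalUnitaryGroupUnimodularIsotropic          -- ★ `isMulRightInvariant_cmDatum_local_antidiagOne` (every Haar measure on `U(Φ_N)(L⁺_v)` is right invariant)
import Literature.NumberTheory.Automorphic.UnitaryGroupPureTensorEulerProduct            -- ★ `secondCountableTopology_gl_adicCompletion`, `locallyCompactSpace_gl_adicCompletion`; brings ★ `secondCountableTopology_adicCompletion`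
import Literature.NumberTheory.Automorphic.ValuedFieldValuativeRelBridge                 -- ★ `v_eq_iff_valuation_eq`, `v_lt_one_iff_valuation_lt_one` (`Valued` ∕ `ValuativeRel` dictionary)
import Literature.NumberTheory.Automorphic.CartanDecompositionGLnPowers                  -- ★ `exists_isUniformizingElement`, `IsUniformizingElement.valuation_lt_one`
import HarnessLib

/-!
# h413 ∕ Track B «K2-LIT», line `K2_E3_EllipticInputs`, unit U12, road (11-SC), letter (SC-an) — brick [M2a], FILE A: THE FRAME OF THE ONE-PLACE MODEL
# `U(σ_w, Φ₃)(L_w)` AT A NON-SPLIT PLACE — scalar inputs, scalar and compact centre, countability ∕ local compactness, unimodularity, Haar-null singular set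
# (Rogawski 1990, §1.9–§1.10, §4.9, §12.2; Platonov–Rapinchuk 1994, §2.3, §3.5, §5.1; Harish-Chandra 1970, Lemma 42)

Cell `pub/hodgecm-mathlib`, crux H413 = `stmt-HodgeConjecture-24833`, route of record `HCCMUnconditional`; chair K2-lead (g0), dealer K2E3-plan (g2), line lead of the
(SC-an) END-GAME MAP K2E3-p20 (g3) ([M1] ★ p856720, [M3] ★ p856699, [M4] in flight).  THEOREMS ONLY (no `def`, no `instance`, no `notation`, no named-fact hypothesis,
no `sorry`); lane `--supports stmt-HodgeConjecture-24833 --as helper`, count-neutral.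

WHAT THIS FILE DISCHARGES.  The field-model theorems of the line ([M1] ★ `K2E3SupercuspOrbitalSliceCuspidalModel`, [M3] ★ `K2E3CuspFormCancellationU3`, ★
`K2E3CuspFormCancellationU3Inputs`, [M4]) are stated for `U = U(σ, J)(K)` over an abstract non-archimedean local field with FRAME HYPOTHESES.  Here `K := L_w = w.1.adicCompletion L`
at a place `w ∣ v` FIXED by complex conjugation (`v` non-split), `σ := σ_w = galAdicCompletionMap c hw`, `J = Φ₃ = (StdForm.antidiagonal 3).over L_w` (the target of ★ (f2) p856722
`K2E3RankOneIsotropicPhi3Model`), and every frame hypothesis is a NAMED THEOREM (or an already-★ one-liner, listed):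
* (a) scalars: `hσσ` = ★ `galAdicCompletionMap_galAdicCompletionMap_of_smul_eq`; `hσc` = ★ `continuous_galAdicCompletionMap`; `hσv` = ★ `valued_galAdicCompletionMap` and
  `valuation_galAdicCompletionMap` (§1, the `ValuativeRel` reading); `h2` = ★ `Rogawski1990.two_ne_zero_adicCompletion` (`FinExplicitTransferFactorDeepTauAnyPlace`) or `two_ne_zero` under `charZero_of_injective_algebraMap`; uniformisers: ★ `exists_v_eq_exp_neg_one_adicCompletion`
  (`Valued.v ϖ = exp(−1)`) and **`exists_ne_zero_valuation_lt_one_map_eq`** (§1: a `σ_w`-FIXED `ϖ′ = ϖ·σ_w ϖ` with `ϖ′ ≠ 0`, `valuation ϖ′ < 1` — the `hϖ0 hϖ1 hσϖ` of [M1]);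
  `over_three_hermitian` ∕ `isUnit_det_over_three` (§1: `Φ₃` is `σ_w`-hermitian with unit determinant); the centre: **`exists_coe_eq_scalar_of_mem_center`** (`hZs`, §2) and
  **`isCompact_center_of_eq_over`** (`hZc`, §2: transport of ★ `local_nonsplit_compactOpen_center_of_center_le` along ★ `localNonsplitEquiv`).
* (b) instances as theorems (§3): `secondCountableTopology_unitaryGroupOfForm_adicCompletion`, `locallyCompactSpace_unitaryGroupOfForm_adicCompletion` (any `J`; `K`, `GL₃(K)`:
  ★ `secondCountableTopology_adicCompletion`, ★ `secondCountableTopology_gl_adicCompletion`, ★ `locallyCompactSpace_gl_adicCompletion`).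
* (c) UNIMODULARITY (§4): **`isMulRightInvariant_of_isHaarMeasure_of_eq_over`** — every left Haar measure on `U(σ_w, Φ₃)(L_w)` is right invariant (★
  `isMulRightInvariant_cmDatum_local_antidiagOne` on `U(Φ₃)(L⁺_v)` pushed along ★ `localNonsplitEquiv`) — the `[μ.IsMulRightInvariant]` of ★ p856672 `cuspForm_cancellation_levelOne`.
* (e) SINGULAR SET (§5): **`measure_setOf_not_isRegularElt_eq_zero_of_eq_over`** ∕ **`ae_isRegularElt_of_eq_over`** — the non-regular elements of `U(σ_w, Φ₃)(L_w)` are Haar-null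
  (★ `exists_closed_null_superset_singular` with `ᵗσ_w(P) Φ₃ P = diag(2,1,−2)`, ★ `formCongr_quasiSplitFrame_eq_diagonal`).
Items (d) (the Cartan dichotomy `g = y t y⁻¹`) and (f) (the support datum of the supercuspidal slice) are FILE B `K2E3SupercuspModelFrameAtPlaceCartan`.

HONEST LABEL.  HC_CM is proved only modulo the 7 printed citations (2 remaining named inputs: hLiu418 = `stmt-HodgeConjecture-24832`, h413 = `stmt-HodgeConjecture-24833`)
until rung 0 closes; this file is a count-neutral helper (place-level plumbing; nothing printed is asserted as a fact).

## References
* [Rogawski1990] J. D. Rogawski, *Automorphic Representations of Unitary Groups in Three Variables*, Ann. of Math. Stud. 123 (1990), §1.9–§1.10 pp. 8–9, §4.9 p. 54, §12.2 p. 173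
  («the centre of `U(3)(E_w∕F_v)` is compact»), §12.5 p. 182.
* [PlatonovRapinchuk1994] V. Platonov, A. Rapinchuk, *Algebraic Groups and Number Theory* (1994), §2.3, §3.5, §5.1.
* [HarishChandra1970] Harish-Chandra (notes by G. van Dijk), *Harmonic Analysis on Reductive p-adic Groups*, LNM 162 (1970), Part V Lemma 42 (the singular set is null).
-/

set_option autoImplicit false
set_option linter.dupNamespace false  -- the mandated namespace repeats the single-problem summit's segment (`HodgeConjecture.HodgeConjecture`)

noncomputable section

open NumberField IsDedekindDomain MeasureTheory Measure Filter Topology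
open Literature.NumberTheory.Automorphic Literature.NumberTheory.Automorphic.UnitaryGroup Literature.NumberTheory.GaloisRepresentations
open Literature.NumberTheory.Rogawski1990 ValuativeRel
open scoped Matrix MatrixGroups

namespace Summit.HodgeConjecture.HodgeConjecture.Cruxes.H413.K2E3SupercuspModelFrameAtPlace

variable (L : Type) [Field L] [NumberField L] [IsCMField L] {v : HeightOneSpectrum (𝓞 ↥(maximalRealSubfield L))}
  (w : PlacesOver L v) (hw : IsCMField.complexConj L • w.1 = w.1)

/-! ## §1 Scalar inputs at `L_w` -/

/-- `σ_w` is isometric in the `ValuativeRel` reading: `valuation (σ_w x) = valuation x` (★ `valued_galAdicCompletionMap` through ★ `v_eq_iff_valuation_eq`) — the `hσv` of ★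
`K2E3CuspFormCancellationU3Inputs` in its `valuation` currency. [cite: PlatonovRapinchuk1994, §5.1] -/
theorem valuation_galAdicCompletionMap (x : w.1.adicCompletion L) :
    valuation (w.1.adicCompletion L) (galAdicCompletionMap (L := L) (IsCMField.complexConj L) hw x) = valuation (w.1.adicCompletion L) x :=
  (v_eq_iff_valuation_eq _ _).1 (valued_galAdicCompletionMap (L := L) (IsCMField.complexConj L) hw x)

/-- **A `σ_w`-FIXED SCALAR OF VALUATION `< 1`** (the `hϖ0 hϖ1 hσϖ` of [M1] ∕ ★ `coinvariants_subsingleton_of_isSupercuspidal`): `ϖ′ = y · σ_w y` for a uniformiser `y`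
of `L_w` is non-zero, `σ_w`-fixed (`σ_w² = 1`), and `|ϖ′| = |y|² < 1`. [cite: Rogawski1990, §12.2 p. 173] [cite: PlatonovRapinchuk1994, §5.1] -/
theorem exists_ne_zero_valuation_lt_one_map_eq :
    ∃ ϖ : w.1.adicCompletion L, ϖ ≠ 0 ∧ valuation (w.1.adicCompletion L) ϖ < 1 ∧ galAdicCompletionMap (L := L) (IsCMField.complexConj L) hw ϖ = ϖ := by
  have hσσ : ∀ x, galAdicCompletionMap (L := L) (IsCMField.complexConj L) hw (galAdicCompletionMap (L := L) (IsCMField.complexConj L) hw x) = x :=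
    galAdicCompletionMap_galAdicCompletionMap_of_smul_eq (IsCMField.complexConj L) w (IsCMField.complexConj_ne_one L) hw
  obtain ⟨y, hy⟩ := exists_isUniformizingElement (F := w.1.adicCompletion L)
  refine ⟨y * galAdicCompletionMap (L := L) (IsCMField.complexConj L) hw y, ?_, ?_, ?_⟩
  · exact mul_ne_zero hy.ne_zero ((map_ne_zero_iff _ (galAdicCompletionMap (L := L) (IsCMField.complexConj L) hw).injective).2 hy.ne_zero)
  · rw [map_mul, valuation_galAdicCompletionMap L w hw]
    exact mul_lt_one_of_nonneg_of_lt_one_left zero_le hy.valuation_lt_one hy.valuation_lt_one.le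
  · rw [map_mul, hσσ, mul_comm]

omit [NumberField L] [IsCMField L] in
/-- `Φ₃ = (StdForm.antidiagonal 3).over L_w` is `σ`-hermitian for ANY ring endomorphism `σ` (its entries are `0, 1`: ★ `StdForm.over_map`, ★ `StdForm.transpose_over`).
[cite: Rogawski1990, §1.9 p. 8] -/
theorem over_three_hermitian {K : Type*} [CommRing K] (σ : K →+* K) :
    (((StdForm.antidiagonal 3).over K).map σ)ᵀ = (StdForm.antidiagonal 3).over K := by
  rw [StdForm.over_map, StdForm.transpose_over]

omit [NumberField L] [IsCMField L] in
/-- `det Φ₃` is a unit (`Φ₃² = 1`, ★ `StdForm.isUnit_over`). [cite: Rogawski1990, §1.9 p. 8] -/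
theorem isUnit_det_over_three {K : Type*} [CommRing K] : IsUnit ((StdForm.antidiagonal 3).over K).det :=
  (Matrix.isUnit_iff_isUnit_det _).1 ((StdForm.antidiagonal 3).isUnit_over K)

omit [IsCMField L] in
/-- The one-place form of the literal `Φ₃ = (i, j) ↦ [i + j + 1 = 3]` (★ `Rogawski1990.qsForm`) at `w` IS `(StdForm.antidiagonal 3).over L_w` (★ `antidiagOne_eq_over`, ★
`StdForm.over_map`). [cite: Rogawski1990, §1.9 p. 8] -/
theorem placeForm_qsForm_eq_over : placeForm (qsForm L) w.1 = (StdForm.antidiagonal 3).over (w.1.adicCompletion L) := by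
  rw [placeForm, qsForm, antidiagOne_eq_over, StdForm.over_map]

/-! ## §2 The centre of `U(σ_w, Φ₃)(L_w)`: scalar and compact -/

/-- **THE CENTRE IS SCALAR** (`hZs` of [M1]): every central element of `U(σ_w, J)(L_w)`, `J = Φ₃`, is `u · 1₃` (★ `exists_coe_eq_scalar_of_mem_center_unitaryGroupOfForm`: `σ_w`
involution, `J` hermitian with `det ≠ 0`, `2, 3 ≠ 0` in characteristic `0`). [cite: PlatonovRapinchuk1994, §2.3] [cite: Rogawski1990, §12.2 p. 173] -/
theorem exists_coe_eq_scalar_of_mem_center {J : Matrix (Fin 3) (Fin 3) (w.1.adicCompletion L)} (hJ : J = (StdForm.antidiagonal 3).over (w.1.adicCompletion L)) :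
    ∀ z ∈ Subgroup.center ↥(unitaryGroupOfForm (galAdicCompletionMap (L := L) (IsCMField.complexConj L) hw) J),
      ∃ u : (w.1.adicCompletion L)ˣ, ((z : ↥(unitaryGroupOfForm (galAdicCompletionMap (L := L) (IsCMField.complexConj L) hw) J)) :
        GL (Fin 3) (w.1.adicCompletion L)) = Matrix.GeneralLinearGroup.scalar (Fin 3) u := by
  subst hJ
  haveI : CharZero (w.1.adicCompletion L) := charZero_of_injective_algebraMap (algebraMap L (w.1.adicCompletion L)).injective
  intro z hz
  exact exists_coe_eq_scalar_of_mem_center_unitaryGroupOfForm (galAdicCompletionMap (L := L) (IsCMField.complexConj L) hw)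
    ((StdForm.antidiagonal 3).over (w.1.adicCompletion L))
    (galAdicCompletionMap_galAdicCompletionMap_of_smul_eq (IsCMField.complexConj L) w (IsCMField.complexConj_ne_one L) hw)
    (over_three_hermitian _) (isUnit_det_over_three.ne_zero) two_ne_zero three_ne_zero hz

/-- Transport of the centre along an isomorphism of groups: `e '' Z(G) = Z(G′)`. [cite: PlatonovRapinchuk1994, §2.3] -/
theorem image_center_eq_of_mulEquiv {G G' F : Type*} [Group G] [Group G'] [EquivLike F G G'] [MulEquivClass F G G'] (e : F) :
    (e : G → G') '' ((Subgroup.center G : Subgroup G) : Set G) = ((Subgroup.center G' : Subgroup G') : Set G') := by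
  ext z
  constructor
  · rintro ⟨g, hg, rfl⟩
    rw [SetLike.mem_coe, Subgroup.mem_center_iff]
    intro h
    obtain ⟨g', rfl⟩ := EquivLike.surjective e h
    rw [← map_mul, ← map_mul, (Subgroup.mem_center_iff.1 hg) g']
  · intro hz
    obtain ⟨g, rfl⟩ := EquivLike.surjective e z
    refine ⟨g, ?_, rfl⟩
    rw [SetLike.mem_coe, Subgroup.mem_center_iff] at hz ⊢
    intro h
    apply EquivLike.injective e
    rw [map_mul, map_mul]
    exact hz (e h)

/-- **THE CENTRE OF THE ONE-PLACE MODEL IS COMPACT** for EVERY hermitian `H ∈ M_N(L)` with unit determinant at a non-split `w ∣ v`: `Z(U(σ_w, H_w)(L_w))` is the image of the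
compact `Z(U(H)(L⁺_v))` (★ `local_nonsplit_compactOpen_center_of_center_le` ∘ ★ `forall_mem_center_cmLocal_eq_scalar`) under ★ `localNonsplitEquiv`.
[cite: Rogawski1990, §12.2 p. 173] [cite: PlatonovRapinchuk1994, §5.1] -/
theorem isCompact_center_unitaryGroupOfForm_placeForm {N : ℕ} (H : Matrix (Fin N) (Fin N) L) (hH : (H.map (cmConjRingHom L))ᵀ = H) (hHd : IsUnit H.det) :
    IsCompact ((Subgroup.center ↥(unitaryGroupOfForm (galAdicCompletionMap (L := L) (IsCMField.complexConj L) hw) (placeForm H w.1)) :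
      Subgroup ↥(unitaryGroupOfForm (galAdicCompletionMap (L := L) (IsCMField.complexConj L) hw) (placeForm H w.1))) :
        Set ↥(unitaryGroupOfForm (galAdicCompletionMap (L := L) (IsCMField.complexConj L) hw) (placeForm H w.1))) := by
  have hns : ∀ w' : PlacesOver L v, IsCMField.complexConj L • w'.1 = w'.1 := fun w' => by
    haveI := PlacesOver.subsingleton_of_smul_eq (IsCMField.complexConj L) (IsCMField.complexConj_ne_one L) w hw
    rw [Subsingleton.elim w' w]; exact hw
  have h0 : IsCompact ((Subgroup.center ↥(«local» L (IsCMField.complexConj L) N H v) : Subgroup ↥(«local» L (IsCMField.complexConj L) N H v)) :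
      Set ↥(«local» L (IsCMField.complexConj L) N H v)) :=
    (F0P3bLocalNonsplitCompactCenter.local_nonsplit_compactOpen_center_of_center_le L N H hHd v hns
      (forall_mem_center_cmLocal_eq_scalar L H hH hHd v hns)).2
  set e := localNonsplitEquiv (IsCMField.complexConj L) H (IsCMField.complexConj_ne_one L) w hw with he
  have h1 : IsCompact ((e : ↥(«local» L (IsCMField.complexConj L) N H v) → _) ''
      ((Subgroup.center ↥(«local» L (IsCMField.complexConj L) N H v) : Subgroup ↥(«local» L (IsCMField.complexConj L) N H v)) :
        Set ↥(«local» L (IsCMField.complexConj L) N H v))) :=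
    h0.image (show Continuous (e : ↥(«local» L (IsCMField.complexConj L) N H v) → _) from e.continuous)
  rwa [image_center_eq_of_mulEquiv e] at h1

/-- **`hZc` OF [M1] AT `J = Φ₃`**: the centre of `U(σ_w, Φ₃)(L_w)` is compact (the previous theorem at `H = Φ₃`, read through `placeForm Φ₃ w = (StdForm.antidiagonal 3).over L_w`).
[cite: Rogawski1990, §12.2 p. 173] [cite: PlatonovRapinchuk1994, §5.1] -/
theorem isCompact_center_of_eq_over {J : Matrix (Fin 3) (Fin 3) (w.1.adicCompletion L)} (hJ : J = (StdForm.antidiagonal 3).over (w.1.adicCompletion L)) :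
    IsCompact ((Subgroup.center ↥(unitaryGroupOfForm (galAdicCompletionMap (L := L) (IsCMField.complexConj L) hw) J) :
      Subgroup ↥(unitaryGroupOfForm (galAdicCompletionMap (L := L) (IsCMField.complexConj L) hw) J)) :
        Set ↥(unitaryGroupOfForm (galAdicCompletionMap (L := L) (IsCMField.complexConj L) hw) J)) := by
  obtain rfl : J = placeForm (qsForm L) w.1 := hJ.trans (placeForm_qsForm_eq_over L w).symm
  exact isCompact_center_unitaryGroupOfForm_placeForm L w hw (qsForm L) (antidiagOne_isHermitian L 3) (isUnit_antidiagOne_det L 3)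

/-! ## §3 Countability and local compactness of the model group -/

omit [IsCMField L] in
/-- `U(σ, J)(L_w)` is second countable (a subgroup of `GL₃(L_w)`, ★ `secondCountableTopology_gl_adicCompletion`), for ANY `σ`, `J`. [cite: PlatonovRapinchuk1994, §3.3] -/
theorem secondCountableTopology_unitaryGroupOfForm_adicCompletion {N : ℕ} (σ : w.1.adicCompletion L →+* w.1.adicCompletion L)
    (J : Matrix (Fin N) (Fin N) (w.1.adicCompletion L)) : SecondCountableTopology ↥(unitaryGroupOfForm σ J) := by
  haveI := secondCountableTopology_gl_adicCompletion L N w.1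
  exact TopologicalSpace.Subtype.secondCountableTopology _

/-- `U(σ_w, J)(L_w)` is locally compact (★ `F0P3cStCharTSModelHaarPins.locallyCompactSpace_unitaryGroupOfForm` with `hσc` = ★ `continuous_galAdicCompletionMap`), ANY `J`.
[cite: PlatonovRapinchuk1994, §3.3] -/
theorem locallyCompactSpace_unitaryGroupOfForm_adicCompletion (J : Matrix (Fin 3) (Fin 3) (w.1.adicCompletion L)) :
    LocallyCompactSpace ↥(unitaryGroupOfForm (galAdicCompletionMap (L := L) (IsCMField.complexConj L) hw) J) :=
  F0P3cStCharTSModelHaarPins.locallyCompactSpace_unitaryGroupOfForm _ J (continuous_galAdicCompletionMap L (IsCMField.complexConj L) hw)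

/-! ## §4 Unimodularity: every Haar measure on `U(σ_w, Φ₃)(L_w)` is right invariant -/

/-- **EVERY LEFT HAAR MEASURE ON `U(σ_w, Φ₃)(L_w)` IS RIGHT INVARIANT** (the `[μ.IsMulRightInvariant]` binder of ★ p856672 `cuspForm_cancellation_levelOne` and of the
(SC-an) assembly): ★ `isMulRightInvariant_cmDatum_local_antidiagOne` (every Haar measure on `U(Φ₃)(L⁺_v)` is right invariant — `SU` of an isotropic form is perfect) pushed
forward along the one-place model ★ `localNonsplitEquiv` `U(Φ₃)(L⁺_v) ≃ₜ* U(σ_w, Φ₃)(L_w)` (`μ = (μ ∘ e)_* `; Haar pulls back to Haar).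
[cite: Rogawski1990, §4.9 p. 54] [cite: PlatonovRapinchuk1994, §3.5, §5.1] -/
theorem isMulRightInvariant_of_isHaarMeasure_of_eq_over {J : Matrix (Fin 3) (Fin 3) (w.1.adicCompletion L)}
    (hJ : J = (StdForm.antidiagonal 3).over (w.1.adicCompletion L))
    [MeasurableSpace ↥(unitaryGroupOfForm (galAdicCompletionMap (L := L) (IsCMField.complexConj L) hw) J)]
    [BorelSpace ↥(unitaryGroupOfForm (galAdicCompletionMap (L := L) (IsCMField.complexConj L) hw) J)]
    (μ : Measure ↥(unitaryGroupOfForm (galAdicCompletionMap (L := L) (IsCMField.complexConj L) hw) J)) [μ.IsHaarMeasure] :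
    μ.IsMulRightInvariant := by
  obtain rfl : J = placeForm (qsForm L) w.1 := hJ.trans (placeForm_qsForm_eq_over L w).symm
  letI instM : MeasurableSpace ↥(«local» L (IsCMField.complexConj L) 3 (qsForm L) v) := borel _
  haveI instB : BorelSpace ↥(«local» L (IsCMField.complexConj L) 3 (qsForm L) v) := ⟨rfl⟩
  -- the one-place model `e₀ : U(Φ₃)(L⁺_v) ≃ₜ* U(σ_w, Φ₃)(L_w)` (no cast: `J` IS `placeForm Φ₃ w`)
  set e₀ := localNonsplitEquiv (IsCMField.complexConj L) (qsForm L) (IsCMField.complexConj_ne_one L) w hw with he₀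
  -- pull `μ` back to a Haar measure `μ₀` on `U(Φ₃)(L⁺_v)` (right invariant by ★) and push it forward again
  set μ₀ : Measure ↥(«local» L (IsCMField.complexConj L) 3 (qsForm L) v) := μ.map e₀.symm with hμ₀
  haveI hμ₀H : μ₀.IsHaarMeasure := ContinuousMulEquiv.isHaarMeasure_map μ e₀.symm
  haveI hμ₀R : μ₀.IsMulRightInvariant := @isMulRightInvariant_cmDatum_local_antidiagOne L _ _ _ 3 v instM instB μ₀ hμ₀H
  have he : Measurable (e₀ : ↥(«local» L (IsCMField.complexConj L) 3 (qsForm L) v) → _) := e₀.continuous.measurable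
  have hes : Measurable (e₀.symm : _ → ↥(«local» L (IsCMField.complexConj L) 3 (qsForm L) v)) := e₀.symm.continuous.measurable
  have hback : μ₀.map e₀ = μ := by
    rw [hμ₀, Measure.map_map he hes, show ((e₀ : ↥(«local» L (IsCMField.complexConj L) 3 (qsForm L) v) → _) ∘
      (e₀.symm : _ → ↥(«local» L (IsCMField.complexConj L) 3 (qsForm L) v))) = id from funext fun x => e₀.apply_symm_apply x, Measure.map_id]
  rw [← hback]
  refine ⟨fun h => ?_⟩
  obtain ⟨g, rfl⟩ := e₀.surjective h
  rw [Measure.map_map (measurable_mul_const _) he]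
  conv_rhs => rw [← map_mul_right_eq_self μ₀ g]
  rw [Measure.map_map he (measurable_mul_const _)]
  congr 1

/-! ## §5 The singular set of `U(σ_w, Φ₃)(L_w)` is Haar-null -/

/-- **THE NON-REGULAR ELEMENTS OF `U(σ_w, Φ₃)(L_w)` FORM A HAAR-NULL SET** (Harish-Chandra's Lemma 42 at the model): ★ `exists_closed_null_superset_singular` (`σ_w` a continuous
involution of the characteristic-`0` local field `L_w` with a skew element ★ `exists_skew_ne_zero_adicCompletion` and a fixed null sequence ★ `exists_null_seq_fixed_adicCompletion`)
for `J = Φ₃`, which is congruent to `diag(2, 1, −2)` (★ `formCongr_quasiSplitFrame_eq_diagonal`).  `IsRegularElt` = separable characteristic polynomial (★ `isRegularElt_iff`).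
[cite: HarishChandra1970, Part V Lemma 42] [cite: Rogawski1990, §12.5 p. 182] -/
theorem measure_setOf_not_isRegularElt_eq_zero_of_eq_over {J : Matrix (Fin 3) (Fin 3) (w.1.adicCompletion L)}
    (hJ : J = (StdForm.antidiagonal 3).over (w.1.adicCompletion L))
    [MeasurableSpace ↥(unitaryGroupOfForm (galAdicCompletionMap (L := L) (IsCMField.complexConj L) hw) J)]
    [BorelSpace ↥(unitaryGroupOfForm (galAdicCompletionMap (L := L) (IsCMField.complexConj L) hw) J)]
    (μ : Measure ↥(unitaryGroupOfForm (galAdicCompletionMap (L := L) (IsCMField.complexConj L) hw) J)) [μ.IsHaarMeasure] :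
    μ {g | ¬ IsRegularElt ((g : ↥(unitaryGroupOfForm (galAdicCompletionMap (L := L) (IsCMField.complexConj L) hw) J)) : GL (Fin 3) (w.1.adicCompletion L))} = 0 := by
  obtain rfl : J = placeForm (qsForm L) w.1 := hJ.trans (placeForm_qsForm_eq_over L w).symm
  letI : MeasurableSpace (w.1.adicCompletion L) := borel _
  haveI : BorelSpace (w.1.adicCompletion L) := ⟨rfl⟩
  haveI : SecondCountableTopology (w.1.adicCompletion L) := secondCountableTopology_adicCompletion L w.1
  haveI : CharZero (w.1.adicCompletion L) := charZero_of_injective_algebraMap (algebraMap L (w.1.adicCompletion L)).injective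
  haveI : LocallyCompactSpace (w.1.adicCompletion L) := locallyCompactSpace_adicCompletion L w.1
  have hσc : Continuous (galAdicCompletionMap (L := L) (IsCMField.complexConj L) hw) := continuous_galAdicCompletionMap L (IsCMField.complexConj L) hw
  have hσσ : ∀ x, galAdicCompletionMap (L := L) (IsCMField.complexConj L) hw (galAdicCompletionMap (L := L) (IsCMField.complexConj L) hw x) = x :=
    galAdicCompletionMap_galAdicCompletionMap_of_smul_eq (IsCMField.complexConj L) w (IsCMField.complexConj_ne_one L) hw
  obtain ⟨δ, hσδ, hδ⟩ := exists_skew_ne_zero_adicCompletion (IsCMField.complexConj L) (IsCMField.complexConj_ne_one L) w hw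
  have ha : galAdicCompletionMap (L := L) (IsCMField.complexConj L) hw δ ≠ δ := by
    rw [hσδ]
    intro hneg
    apply hδ
    have h2 : (2 : w.1.adicCompletion L) * δ = 0 := by linear_combination -hneg
    exact (mul_eq_zero.mp h2).resolve_left two_ne_zero
  obtain ⟨ε, hε, hε0, hσε⟩ := exists_null_seq_fixed_adicCompletion (IsCMField.complexConj L) (IsCMField.complexConj_ne_one L) w hw
  -- `Φ₃ ~ diag(2, 1, −2)` through the rational frame `P`
  have hT := F0P3cStCharTSSingularNull.formCongr_quasiSplitFrame_eq_diagonal L w.1 hw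
  obtain ⟨S, hSc, hSsing, hSnull⟩ := Literature.LinearAlgebra.Matrix.exists_closed_null_superset_singular
    (galAdicCompletionMap (L := L) (IsCMField.complexConj L) hw) hσc hσσ ha hε hε0 hσε hT
  exact measure_mono_null (fun g hg => hSsing g hg) (hSnull μ inferInstance)

/-- **ALMOST EVERY ELEMENT OF `U(σ_w, Φ₃)(L_w)` IS REGULAR SEMISIMPLE** (the `∀ᵐ` reading of the previous theorem) — the «singular `g` are null» input of the (SC-an) assembly.
[cite: HarishChandra1970, Part V Lemma 42] [cite: Rogawski1990, §12.5 p. 182] -/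
theorem ae_isRegularElt_of_eq_over {J : Matrix (Fin 3) (Fin 3) (w.1.adicCompletion L)} (hJ : J = (StdForm.antidiagonal 3).over (w.1.adicCompletion L))
    [MeasurableSpace ↥(unitaryGroupOfForm (galAdicCompletionMap (L := L) (IsCMField.complexConj L) hw) J)]
    [BorelSpace ↥(unitaryGroupOfForm (galAdicCompletionMap (L := L) (IsCMField.complexConj L) hw) J)]
    (μ : Measure ↥(unitaryGroupOfForm (galAdicCompletionMap (L := L) (IsCMField.complexConj L) hw) J)) [μ.IsHaarMeasure] :
    ∀ᵐ g ∂μ, IsRegularElt ((g : ↥(unitaryGroupOfForm (galAdicCompletionMap (L := L) (IsCMField.complexConj L) hw) J)) : GL (Fin 3) (w.1.adicCompletion L)) := by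
  rw [ae_iff]
  exact measure_setOf_not_isRegularElt_eq_zero_of_eq_over L w hw hJ μ

end Summit.HodgeConjecture.HodgeConjecture.Cruxes.H413.K2E3SupercuspModelFrameAtPlace

end
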